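import Literature.MathematicalPhysics.QuantumFieldTheory.Balaban1983to89.B6Prop25BoundedTwoScaleV1

/-!
# `Balaban1983to89.B6Repr2129Operator` — T. Bałaban, *Propagators and renormalization transformations for lattice gauge theories. II*,
# Commun. Math. Phys. **96** (1984) 223–250 [Balaban1984PropagatorsII], (2.129)–(2.131) p. 246: the representation (2.129) AS AN OPERATOR
# IDENTITY `G = ∂H′_jC^{(j)}_ΛH′_j*∂* + (I − ∂ΔH′_jC^{(j)}_ΛH′_j*∂*)*(G̃_j + H_jC̃^{(j)}_ΛH_j*)(I − ∂ΔH′_jC^{(j)}_ΛH′_j*∂*)`, the factorisation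
# `G̃_j = (I − H_jQ_j)G_j` of (2.130)/(2.131), and the FREEDOM OF THE WEIGHT: `H_j`, `G̃_j` may be computed from `G′ = (Δ − ∂P_j∂* + Q_j*a′Q_j)⁻¹`
# for ANY positive weight `a′` (so that [4]'s `a`-weighted propagator can be used inside (2.129))

statement-level skeleton of published theorems with citation tags; proofs where landed; nothing here is a claim about the Yang–Mills mass gap

PDF held: `paper:balaban1984-cmp96-propagators-rt-ii` (journal page = PDF page + 222), p. 246 [PDF 24] (text layer `p0024.txt` read this session);
[4] = [Balaban1984PropagatorsI] pp. 29–36.  PRINT (p. 246; the display (2.129) as transcribed from the ×2 image by this seat's gen 8/13 files, the prose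
verbatim from the text layer, grepped this session): *"⟨J,GJ⟩ = ⟨J,∂H′_jC^{(j)}_ΛH′_j*∂*J⟩ + ⟨(J − ∂ΔH′_jC^{(j)}_ΛH′_j*∂*J), (G̃_j + H_jC̃^{(j)}_ΛH_j*)(J −
∂ΔH′_jC^{(j)}_ΛH′_j*∂*J)⟩. (2.129) We have to investigate yet the operators G̃_j, H_j, and H′_j. Doing similar calculations as in Sect. E. (1.91)–(1.103),
in fact much simpler, we get the formula H_j = G_jQ_j*(Q_jG_jQ_j*)⁻¹ (2.130) Thus this operator coincides with the operator introduced in Sect. D. For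
G̃_j we get G̃_j = G_j − G_jQ_j*(Q_jG_jQ_j*)⁻¹Q_jG_j. (2.131) From these representations we obtain all the necessary properties of the operators H_j,
G̃_j. They follow from the Proposition 1.2 and from the formulas and the inequalities (1.99)–(1.101) for Q_jG_jQ_j*."*

CITATION HEADER (lean-in-tree rule) — WHAT IS REPRODUCED.  Phase-2 file of the `lit-balaban` typed skeleton (HOME `run/shared/lean/pub/lit-balaban/`),
seat **p22 gen 14** (B6 fold owner r03, referee ref-4; lane = Sect. C on the concrete two-scale data `…B6SectCTwoScaleV1Lattice.tsV1`), FILE 1 of the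
PROP. 2.5 TWO-LEVEL DECAY programme (target: the (1.110)-type decay members of Prop. 2.5 for the genuine two-scale `G` of (2.90), `Λ′ ≠ ∅`, which
are assembled from the decay of the FACTORS of (2.129) — that needs (2.129) between OPERATORS, not only between quadratic forms); SKELETON rows
**B6.Eq2.129 / B6.Eq2.130 / B6.Eq2.131** (cells only; decls of record untouched).  Until now (2.129) is in the tree as the printed
QUADRATIC-FORM identity (`…B6Repr2129Positivity.eq2129_of_pos`, abstract; `…B6Eq2129TwoScaleV1.eq2129_V1`, concrete).  THIS FILE: §1 the
adjoint bookkeeping (`K₁ = (∂H′_j)C^{(j)}_Λ(∂H′_j)*`, `K₂ = (∂ΔH′_j)C^{(j)}_Λ(∂H′_j)*`, `K₂* = (∂H′_j)C^{(j)}_Λ(∂ΔH′_j)*`, symmetry of every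
piece); §2 **`G_eq_op`**: (2.129) as an identity of OPERATORS on the fine vector fields, by polarization (both sides are symmetric operators
with the same quadratic form — Mathlib `LinearMap.IsSymmetric.inner_map_self_eq_zero`), and pointwise `G_apply`; §3 **`Gt_eq_comp_Gj`**:
`G̃_j = (I − H_jQ_j)G_j` (= (2.131) with (2.130) substituted), `Gt_apply`; §4 THE WEIGHT IS FREE: for every symmetric positive-definite
`a′` on the `Q_j`-fields, with `G′ = (M_j + Q_j*a′Q_j)⁻¹`, `M_j = Δ − ∂P_j∂*`, and `E′ = (Q_jG′Q_j*)⁻¹`: **`Hj_eq_hOp_weight`** (`H_j = G′Q_j*E′`,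
by `…B6Eq2130.hOp_unique`), **`Gt_eq_tildeOp_weight`** (`G̃_j = G′ − G′Q_j*E′Q_jG′`, by `…B6CovarianceOperator.cov_unique`),
**`Gt_eq_comp_weight`** (`G̃_j = (I − H_jQ_j)G′`) — the tree's `G_j` (`…B6SectCOperators.TwoScaleData.Gj`) carries the weight `a = 1`, whereas
[4]'s Propositions 1.1/1.2 are used at a fixed `a > 0` in [4]'s normalisation (V1 weight `a·(L^j)^d`, r03's dictionary `…B6HjGtOpNormV1.inner_QE_aE_whole`);
(2.130)/(2.131) determine `H_j`, `G̃_j` independently of that weight (this file's §4 is the proof); §5 the same for the concrete data `tsV1`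
(`G_eq_op_V1`, `Gt_eq_comp_Gj_V1`, `Gt_eq_comp_smul_V1`, `Hj_eq_hOp_smul_V1`).  IMPORTS BY NAME, restating nothing.  THEOREMS
ONLY (no definition, no `def … : Prop`); standard axioms.  HONEST SCOPE: finite-dimensional identities between the operators DEFINED in
`…B6SectCOperators` under the printed lattice identities (`IsLattice`) and the two positivity facts (`Positive`) — for `tsV1` these are
theorems (`isLattice`, `positive`); no inequality is proved here; NOT summit progress.  Unit `lit-balaban-p22` (gen 14), 2026-08-22.
-/

noncomputable section

open scoped InnerProductSpace

namespace Literature.MathematicalPhysics.QuantumFieldTheory.Balaban1983to89.B6Repr2129Operator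

open B6SectCOperators B6SectCOperators.TwoScaleData B6CovarianceOperator B6SectCTwoScaleV1 B6SectCTwoScaleV1Lattice LatticeFieldCalculus
open BalabanImbrieJaffe1984to88.BIJ85AxialPropagator411 (BondSpace)
open B6SectCPositivity
open B6Repr2129Positivity (eq2129_of_pos)
open B6Prop25BoundedTwoScaleV1 (dv_eq_adjoint_grad)

/-! ## §1  Adjoints and symmetry of the pieces of (2.129) -/

section Abstract

variable {A B W T Bs V : Type*}
  [NormedAddCommGroup A] [InnerProductSpace ℝ A] [FiniteDimensional ℝ A]
  [NormedAddCommGroup B] [InnerProductSpace ℝ B] [FiniteDimensional ℝ B]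
  [NormedAddCommGroup W] [InnerProductSpace ℝ W] [FiniteDimensional ℝ W]
  [NormedAddCommGroup T] [InnerProductSpace ℝ T] [FiniteDimensional ℝ T]
  [NormedAddCommGroup Bs] [InnerProductSpace ℝ Bs] [FiniteDimensional ℝ Bs]
  [NormedAddCommGroup V] [InnerProductSpace ℝ V] [FiniteDimensional ℝ V]
  {D : TwoScaleData A B W T Bs V}

/-- `(∂H′_j)* = H′_j*∂*` (`∂*` is the adjoint of `∂`). [cite: Balaban1984PropagatorsII, (2.19) p.226 + (2.112) p.243] -/
theorem adjoint_grad_hP (hL : D.IsLattice) : LinearMap.adjoint (D.grad ∘ₗ D.hP) = LinearMap.adjoint D.hP ∘ₗ D.dv := by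
  rw [LinearMap.adjoint_comp, ← dv_eq_adjoint_grad hL]

/-- `(∂ΔH′_j)* = H′_j*Δ∂*` (`Δ = ∂*∂` on scalars is symmetric). [cite: Balaban1984PropagatorsII, (2.19) p.226 + (2.112) p.243] -/
theorem adjoint_grad_lap_hP (hL : D.IsLattice) :
    LinearMap.adjoint (D.grad ∘ₗ D.lap ∘ₗ D.hP) = LinearMap.adjoint D.hP ∘ₗ D.lap ∘ₗ D.dv := by
  have hlap : LinearMap.adjoint D.lap = D.lap := by
    symm
    rw [LinearMap.eq_adjoint_iff]
    intro x y
    exact lap_symm hL x y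
  rw [LinearMap.adjoint_comp, LinearMap.adjoint_comp, hlap, ← dv_eq_adjoint_grad hL]
  rfl

/-- `C^{(j)}_Λ` is self-adjoint. [cite: Balaban1984PropagatorsII, (2.110) p.242] -/
theorem adjoint_C (hL : D.IsLattice) (hP : D.Positive) : LinearMap.adjoint D.C = D.C := by
  symm
  rw [LinearMap.eq_adjoint_iff]
  intro x y
  exact C_symm hL hP x y

/-- **`K₁ = (∂H′_j)C^{(j)}_Λ(∂H′_j)*`** — the first operator of (2.129). [cite: Balaban1984PropagatorsII, (2.129) p.246] -/
theorem K1_eq (hL : D.IsLattice) : D.K1 = (D.grad ∘ₗ D.hP) ∘ₗ D.C ∘ₗ LinearMap.adjoint (D.grad ∘ₗ D.hP) := by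
  rw [adjoint_grad_hP hL]
  rfl

/-- **`K₂ = (∂ΔH′_j)C^{(j)}_Λ(∂H′_j)*`** — the operator subtracted from `J` in (2.129). [cite: Balaban1984PropagatorsII, (2.129) p.246] -/
theorem K2_eq (hL : D.IsLattice) : D.K2 = (D.grad ∘ₗ D.lap ∘ₗ D.hP) ∘ₗ D.C ∘ₗ LinearMap.adjoint (D.grad ∘ₗ D.hP) := by
  rw [adjoint_grad_hP hL]
  rfl

/-- **`K₂* = (∂H′_j)C^{(j)}_Λ(∂ΔH′_j)*`**. [cite: Balaban1984PropagatorsII, (2.129) p.246] -/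
theorem adjoint_K2 (hL : D.IsLattice) (hP : D.Positive) :
    LinearMap.adjoint D.K2 = (D.grad ∘ₗ D.hP) ∘ₗ D.C ∘ₗ LinearMap.adjoint (D.grad ∘ₗ D.lap ∘ₗ D.hP) := by
  rw [K2_eq hL, LinearMap.adjoint_comp, LinearMap.adjoint_comp, LinearMap.adjoint_adjoint, adjoint_C hL hP]
  rfl

/-- `K₁` is symmetric. [cite: Balaban1984PropagatorsII, (2.129) p.246] -/
theorem K1_symm (hL : D.IsLattice) (hP : D.Positive) (x y : A) : ⟪D.K1 x, y⟫_ℝ = ⟪x, D.K1 y⟫_ℝ := by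
  have e : ∀ z, D.K1 z = (D.grad ∘ₗ D.hP) (D.C (LinearMap.adjoint (D.grad ∘ₗ D.hP) z)) := fun z => by
    rw [K1_eq hL]; rfl
  rw [e x, e y, ← LinearMap.adjoint_inner_right (D.grad ∘ₗ D.hP), C_symm hL hP, LinearMap.adjoint_inner_left]

/-- `G̃_j` is symmetric (a covariance). [cite: Balaban1984PropagatorsII, (2.131) p.246] -/
theorem Gt_symm (hL : D.IsLattice) (hP : D.Positive) (x y : A) : ⟪D.Gt x, y⟫_ℝ = ⟪x, D.Gt y⟫_ℝ :=
  covOp_symm D.NA D.Mj (Mj_symm hL) (fun k hk => Mj_pos_ker hL hP k k.2 (fun h => hk (Subtype.ext h))) x y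

/-- `C̃^{(j)}_Λ` is symmetric (a covariance). [cite: Balaban1984PropagatorsII, (2.129) p.246] -/
theorem Ct_symm (hL : D.IsLattice) (hP : D.Positive) (x y : Bs) : ⟪D.Ct x, y⟫_ℝ = ⟪x, D.Ct y⟫_ℝ :=
  covOp_symm D.Ax D.Sb (Sb_symm hL) (Sb_pos hL hP) x y

/-- `G̃_j + H_jC̃^{(j)}_ΛH_j*` is symmetric. [cite: Balaban1984PropagatorsII, (2.129) p.246] -/
theorem M_symm (hL : D.IsLattice) (hP : D.Positive) (x y : A) :
    ⟪(D.Gt + D.Hj ∘ₗ D.Ct ∘ₗ LinearMap.adjoint D.Hj) x, y⟫_ℝ = ⟪x, (D.Gt + D.Hj ∘ₗ D.Ct ∘ₗ LinearMap.adjoint D.Hj) y⟫_ℝ := by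
  simp only [LinearMap.add_apply, LinearMap.coe_comp, Function.comp_apply, inner_add_left, inner_add_right]
  rw [Gt_symm hL hP, ← LinearMap.adjoint_inner_right D.Hj, Ct_symm hL hP, LinearMap.adjoint_inner_left]

/-- the conjugated operator `(I − K₂)*M(I − K₂)` is symmetric when `M` is. [cite: Balaban1984PropagatorsII, (2.129) p.246] -/
theorem conj_symm (M K : A →ₗ[ℝ] A) (hM : ∀ x y, ⟪M x, y⟫_ℝ = ⟪x, M y⟫_ℝ) (x y : A) :
    ⟪(LinearMap.adjoint (LinearMap.id - K) ∘ₗ M ∘ₗ (LinearMap.id - K)) x, y⟫_ℝ =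
      ⟪x, (LinearMap.adjoint (LinearMap.id - K) ∘ₗ M ∘ₗ (LinearMap.id - K)) y⟫_ℝ := by
  simp only [LinearMap.coe_comp, Function.comp_apply]
  rw [LinearMap.adjoint_inner_left, hM, LinearMap.adjoint_inner_right]

/-- the quadratic form of the conjugated operator: `⟨J, (I − K₂)*M(I − K₂)J⟩ = ⟨J − K₂J, M(J − K₂J)⟩`. [cite: Balaban1984PropagatorsII, (2.129) p.246] -/
theorem inner_conj_self (M K : A →ₗ[ℝ] A) (J : A) :
    ⟪J, (LinearMap.adjoint (LinearMap.id - K) ∘ₗ M ∘ₗ (LinearMap.id - K)) J⟫_ℝ = ⟪J - K J, M (J - K J)⟫_ℝ := by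
  simp only [LinearMap.coe_comp, Function.comp_apply, LinearMap.sub_apply, LinearMap.id_apply]
  rw [LinearMap.adjoint_inner_right]
  rfl

/-! ## §2  (2.129) as an operator identity -/

omit [FiniteDimensional ℝ A] in
/-- two symmetric operators with the same quadratic form are equal (polarization). [folklore] -/
private theorem eq_of_symm_of_inner_self_eq (S₁ S₂ : A →ₗ[ℝ] A) (h₁ : ∀ x y, ⟪S₁ x, y⟫_ℝ = ⟪x, S₁ y⟫_ℝ)
    (h₂ : ∀ x y, ⟪S₂ x, y⟫_ℝ = ⟪x, S₂ y⟫_ℝ) (h : ∀ x, ⟪x, S₁ x⟫_ℝ = ⟪x, S₂ x⟫_ℝ) : S₁ = S₂ := by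
  have hsym : (S₁ - S₂).IsSymmetric := fun x y => by
    rw [LinearMap.sub_apply, LinearMap.sub_apply, inner_sub_left, inner_sub_right, h₁, h₂]
  have h0 : ∀ x, ⟪(S₁ - S₂) x, x⟫_ℝ = 0 := fun x => by
    rw [LinearMap.sub_apply, inner_sub_left, real_inner_comm, h, real_inner_comm (S₂ x), sub_self]
  exact sub_eq_zero.mp (hsym.inner_map_self_eq_zero.mp h0)

/-- **(2.129) AS AN OPERATOR IDENTITY**: for two-scale data satisfying the printed lattice identities and the two positivity facts,
`G = ∂H′_jC^{(j)}_ΛH′_j*∂* + (I − ∂ΔH′_jC^{(j)}_ΛH′_j*∂*)*(G̃_j + H_jC̃^{(j)}_ΛH_j*)(I − ∂ΔH′_jC^{(j)}_ΛH′_j*∂*)`, i.e.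
`G = K₁ + (I − K₂)*(G̃_j + H_jC̃^{(j)}_ΛH_j*)(I − K₂)` — both sides are symmetric operators and the printed (2.129) says their quadratic
forms agree. [cite: Balaban1984PropagatorsII, (2.129) p.246] -/
theorem G_eq_op (hL : D.IsLattice) (hP : D.Positive) :
    D.G = D.K1 + LinearMap.adjoint (LinearMap.id - D.K2) ∘ₗ (D.Gt + D.Hj ∘ₗ D.Ct ∘ₗ LinearMap.adjoint D.Hj) ∘ₗ (LinearMap.id - D.K2) := by
  refine eq_of_symm_of_inner_self_eq _ _ (G_symm hL hP) (fun x y => ?_) (fun J => ?_)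
  · rw [LinearMap.add_apply, LinearMap.add_apply, inner_add_left, inner_add_right, K1_symm hL hP,
      conj_symm _ _ (M_symm hL hP)]
  · rw [LinearMap.add_apply, inner_add_right, inner_conj_self, eq2129_of_pos hL hP J]

/-- **(2.129) pointwise**: `GJ = K₁J + (I − K₂)*[(G̃_j + H_jC̃^{(j)}_ΛH_j*)(J − K₂J)]`. [cite: Balaban1984PropagatorsII, (2.129) p.246] -/
theorem G_apply (hL : D.IsLattice) (hP : D.Positive) (J : A) :
    D.G J = D.K1 J + LinearMap.adjoint (LinearMap.id - D.K2) ((D.Gt + D.Hj ∘ₗ D.Ct ∘ₗ LinearMap.adjoint D.Hj) (J - D.K2 J)) := by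
  conv_lhs => rw [G_eq_op hL hP]
  rfl

/-- the adjoint factor written out: `(I − K₂)*u = u − K₂*u = u − (∂H′_j)C^{(j)}_Λ(∂ΔH′_j)*u`. [cite: Balaban1984PropagatorsII, (2.129) p.246] -/
theorem adjoint_one_sub_K2_apply (hL : D.IsLattice) (hP : D.Positive) (u : A) :
    LinearMap.adjoint (LinearMap.id - D.K2) u =
      u - D.grad (D.hP (D.C (LinearMap.adjoint (D.grad ∘ₗ D.lap ∘ₗ D.hP) u))) := by
  rw [map_sub, LinearMap.sub_apply, adjoint_K2 hL hP]
  have hid : LinearMap.adjoint (LinearMap.id : A →ₗ[ℝ] A) = LinearMap.id := by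
    symm; rw [LinearMap.eq_adjoint_iff]; intro x y; rfl
  rw [hid]
  rfl

/-- `K₂J = ∂ΔH′_jC^{(j)}_Λ(∂H′_j)*J` written out. [cite: Balaban1984PropagatorsII, (2.129) p.246] -/
theorem K2_apply (hL : D.IsLattice) (J : A) :
    D.K2 J = D.grad (D.lap (D.hP (D.C (LinearMap.adjoint (D.grad ∘ₗ D.hP) J)))) := by
  rw [K2_eq hL]
  rfl

/-- `K₁J = ∂H′_jC^{(j)}_Λ(∂H′_j)*J` written out. [cite: Balaban1984PropagatorsII, (2.129) p.246] -/
theorem K1_apply (hL : D.IsLattice) (J : A) :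
    D.K1 J = D.grad (D.hP (D.C (LinearMap.adjoint (D.grad ∘ₗ D.hP) J))) := by
  rw [K1_eq hL]
  rfl

/-! ## §3  `G̃_j = (I − H_jQ_j)G_j` — (2.131) with (2.130) substituted -/

/-- **`G̃_j = (I − H_jQ_j)G_j`**: `G_j − G_jQ_j*(Q_jG_jQ_j*)⁻¹Q_jG_j = G_j − H_jQ_jG_j` by (2.130).
[cite: Balaban1984PropagatorsII, (2.130)–(2.131) p.246] -/
theorem Gt_eq_comp_Gj (hL : D.IsLattice) (hP : D.Positive) : D.Gt = (LinearMap.id - D.Hj ∘ₗ D.Qv) ∘ₗ D.Gj := by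
  rw [Gt_eq_tildeOp hL hP]
  refine LinearMap.ext fun J => ?_
  simp only [B6SectA.tildeOp, B6SectA.hOp, TwoScaleData.Hj, LinearMap.sub_apply, LinearMap.comp_apply, LinearMap.id_apply]

/-- pointwise: `G̃_jJ = G_jJ − H_j(Q_jG_jJ)`. [cite: Balaban1984PropagatorsII, (2.130)–(2.131) p.246] -/
theorem Gt_apply (hL : D.IsLattice) (hP : D.Positive) (J : A) : D.Gt J = D.Gj J - D.Hj (D.Qv (D.Gj J)) := by
  rw [Gt_eq_comp_Gj hL hP]
  rfl

-- (`H_jB = G_jQ_j*E_jB` pointwise is the tree's `…B6Eq2118DeltaJInverse.Hj_apply`; not restated — gate dedup rule.)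

/-! ## §4  The weight is free: `H_j`, `G̃_j` from `G′ = (M_j + Q_j*a′Q_j)⁻¹` for any positive `a′` -/

section Weight

variable (a' : Bs →ₗ[ℝ] Bs)

/-- `⟨v, (M_j + Q_j*a′Q_j)v⟩ = ⟨v, M_jv⟩ + ⟨Q_jv, a′Q_jv⟩`. [cite: Balaban1984PropagatorsII, (2.19)–(2.20) p.226] -/
theorem inner_MjQa (v : A) :
    ⟪v, (D.Mj + LinearMap.adjoint D.Qv ∘ₗ a' ∘ₗ D.Qv) v⟫_ℝ = ⟪v, D.Mj v⟫_ℝ + ⟪D.Qv v, a' (D.Qv v)⟫_ℝ := by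
  rw [LinearMap.add_apply, inner_add_right, LinearMap.comp_apply, LinearMap.comp_apply, LinearMap.adjoint_inner_right]

/-- **`M_j + Q_j*a′Q_j > 0`** for a positive-definite weight `a′` ([4] p. 29 *"Δ_a … is bounded from below by a positive constant"*, here
qualitatively: `M_j ≥ 0`, `M_j > 0` on `{Q_jA = 0} ∖ 0`, `a′ > 0`). [cite: Balaban1984PropagatorsII, (2.19)–(2.22) p.226 + (2.130) p.246] -/
theorem MjQa_pos (hL : D.IsLattice) (hP : D.Positive) (hap : ∀ x : Bs, x ≠ 0 → 0 < ⟪x, a' x⟫_ℝ) (v : A) (hv : v ≠ 0) :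
    0 < ⟪v, (D.Mj + LinearMap.adjoint D.Qv ∘ₗ a' ∘ₗ D.Qv) v⟫_ℝ := by
  rw [inner_MjQa]
  by_cases hQ : D.Qv v = 0
  · rw [hQ, map_zero, inner_zero_left, add_zero]
    exact Mj_pos_ker hL hP v hQ hv
  · exact add_pos_of_nonneg_of_pos (form_Mj_nonneg hL v) (hap _ hQ)

/-- `M_j + Q_j*a′Q_j` is symmetric for symmetric `a′`. [cite: Balaban1984PropagatorsII, (2.19) p.226] -/
theorem MjQa_symm (hL : D.IsLattice) (has : ∀ x y : Bs, ⟪a' x, y⟫_ℝ = ⟪x, a' y⟫_ℝ) (x y : A) :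
    ⟪(D.Mj + LinearMap.adjoint D.Qv ∘ₗ a' ∘ₗ D.Qv) x, y⟫_ℝ = ⟪x, (D.Mj + LinearMap.adjoint D.Qv ∘ₗ a' ∘ₗ D.Qv) y⟫_ℝ := by
  simp only [LinearMap.add_apply, LinearMap.coe_comp, Function.comp_apply, inner_add_left, inner_add_right]
  rw [Mj_symm hL, LinearMap.adjoint_inner_left, has, LinearMap.adjoint_inner_right]

/-- `(M_j + Q_j*a′Q_j)G′ = I` for `G′ = (M_j + Q_j*a′Q_j)⁻¹` — [4] (1.69)–(1.71) with the weight `a′`. [cite: Balaban1984PropagatorsII, (2.130) p.246] -/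
theorem MjQa_comp_inverse (hL : D.IsLattice) (hP : D.Positive) (hap : ∀ x : Bs, x ≠ 0 → 0 < ⟪x, a' x⟫_ℝ) :
    (D.Mj + LinearMap.adjoint D.Qv ∘ₗ a' ∘ₗ D.Qv) ∘ₗ Ring.inverse (D.Mj + LinearMap.adjoint D.Qv ∘ₗ a' ∘ₗ D.Qv) = LinearMap.id :=
  comp_inverse _ (MjQa_pos a' hL hP hap)

/-- `G′ = (M_j + Q_j*a′Q_j)⁻¹` is positive definite. [cite: Balaban1984PropagatorsII, p.228 + (2.130) p.246] -/
theorem Ga_pos (hL : D.IsLattice) (hP : D.Positive) (hap : ∀ x : Bs, x ≠ 0 → 0 < ⟪x, a' x⟫_ℝ) (x : A) (hx : x ≠ 0) :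
    0 < ⟪x, Ring.inverse (D.Mj + LinearMap.adjoint D.Qv ∘ₗ a' ∘ₗ D.Qv) x⟫_ℝ :=
  inverse_pos _ (MjQa_pos a' hL hP hap) x hx

/-- `G′` is symmetric. [cite: Balaban1984PropagatorsII, p.228 + (2.130) p.246] -/
theorem Ga_symm (hL : D.IsLattice) (hP : D.Positive) (has : ∀ x y : Bs, ⟪a' x, y⟫_ℝ = ⟪x, a' y⟫_ℝ)
    (hap : ∀ x : Bs, x ≠ 0 → 0 < ⟪x, a' x⟫_ℝ) (x y : A) :
    ⟪Ring.inverse (D.Mj + LinearMap.adjoint D.Qv ∘ₗ a' ∘ₗ D.Qv) x, y⟫_ℝ =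
      ⟪x, Ring.inverse (D.Mj + LinearMap.adjoint D.Qv ∘ₗ a' ∘ₗ D.Qv) y⟫_ℝ :=
  inverse_symm _ (MjQa_symm a' hL has) (MjQa_pos a' hL hP hap) x y

/-- *"QGQ* is positive also and an inverse is a well-defined and positive operator"* (p. 228), for `Q_jG′Q_j*`.
[cite: Balaban1984PropagatorsII, p.228 + (2.130) p.246] -/
theorem QGaQ_pos (hL : D.IsLattice) (hP : D.Positive) (hap : ∀ x : Bs, x ≠ 0 → 0 < ⟪x, a' x⟫_ℝ) (b : Bs) (hb : b ≠ 0) :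
    0 < ⟪b, (D.Qv ∘ₗ Ring.inverse (D.Mj + LinearMap.adjoint D.Qv ∘ₗ a' ∘ₗ D.Qv) ∘ₗ LinearMap.adjoint D.Qv) b⟫_ℝ := by
  have hb' : LinearMap.adjoint D.Qv b ≠ 0 := fun h => hb (Qv_adjoint_injective hL (by rw [h, map_zero]))
  simp only [LinearMap.coe_comp, Function.comp_apply]
  rw [← LinearMap.adjoint_inner_left]
  exact Ga_pos a' hL hP hap _ hb'

/-- `(Q_jG′Q_j*)E′ = I` for `E′ = (Q_jG′Q_j*)⁻¹`. [cite: Balaban1984PropagatorsII, (2.130) p.246] -/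
theorem QGaQ_comp_inverse (hL : D.IsLattice) (hP : D.Positive) (hap : ∀ x : Bs, x ≠ 0 → 0 < ⟪x, a' x⟫_ℝ) :
    (D.Qv ∘ₗ Ring.inverse (D.Mj + LinearMap.adjoint D.Qv ∘ₗ a' ∘ₗ D.Qv) ∘ₗ LinearMap.adjoint D.Qv) ∘ₗ
        Ring.inverse (D.Qv ∘ₗ Ring.inverse (D.Mj + LinearMap.adjoint D.Qv ∘ₗ a' ∘ₗ D.Qv) ∘ₗ LinearMap.adjoint D.Qv) =
      LinearMap.id :=
  comp_inverse _ (QGaQ_pos a' hL hP hap)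

/-- **THE WEIGHT IS FREE — `H_j`**: for every positive-definite weight `a′`, the printed `H_j = G_jQ_j*(Q_jG_jQ_j*)⁻¹` (2.130) (the
tree's `G_j` has `a = 1`) equals `G′Q_j*(Q_jG′Q_j*)⁻¹` with `G′ = (Δ − ∂P_j∂* + Q_j*a′Q_j)⁻¹` — both are the unique critical
configuration of `½⟨A,(Δ − ∂P_j∂*)A⟩` on `{Q_jA = B}` (`…B6Eq2130.hOp_unique`). [cite: Balaban1984PropagatorsII, (2.130) p.246] -/
theorem Hj_eq_hOp_weight (hL : D.IsLattice) (hP : D.Positive) (hap : ∀ x : Bs, x ≠ 0 → 0 < ⟪x, a' x⟫_ℝ) :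
    D.Hj = B6SectA.hOp (Ring.inverse (D.Mj + LinearMap.adjoint D.Qv ∘ₗ a' ∘ₗ D.Qv)) (LinearMap.adjoint D.Qv)
      (Ring.inverse (D.Qv ∘ₗ Ring.inverse (D.Mj + LinearMap.adjoint D.Qv ∘ₗ a' ∘ₗ D.Qv) ∘ₗ LinearMap.adjoint D.Qv)) := by
  refine LinearMap.ext fun b => ?_
  exact B6Eq2130.hOp_unique D.Mj _ D.Qv (LinearMap.adjoint D.Qv) a' _ Qvs_adj (MjQa_comp_inverse a' hL hP hap)
    (QGaQ_comp_inverse a' hL hP hap) (fun v hv h0 => by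
      by_contra hne
      exact (Mj_pos_ker hL hP v hv hne).ne' h0) b (D.Hj b) (Qv_Hj hL hP b) (fun v hv => Hj_crit hL hP b v hv)

/-- **THE WEIGHT IS FREE — `G̃_j` in the printed shape (2.131)**: `G̃_j = G′ − G′Q_j*(Q_jG′Q_j*)⁻¹Q_jG′` for every positive-definite
weight `a′` (uniqueness of the covariance of `Δ − ∂P_j∂*` on `{Q_jA = 0}`, `…B6CovarianceOperator.cov_unique`).
[cite: Balaban1984PropagatorsII, (2.131) p.246] -/
theorem Gt_eq_tildeOp_weight (hL : D.IsLattice) (hP : D.Positive) (hap : ∀ x : Bs, x ≠ 0 → 0 < ⟪x, a' x⟫_ℝ) :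
    D.Gt = B6SectA.tildeOp (Ring.inverse (D.Mj + LinearMap.adjoint D.Qv ∘ₗ a' ∘ₗ D.Qv)) D.Qv (LinearMap.adjoint D.Qv)
      (Ring.inverse (D.Qv ∘ₗ Ring.inverse (D.Mj + LinearMap.adjoint D.Qv ∘ₗ a' ∘ₗ D.Qv) ∘ₗ LinearMap.adjoint D.Qv)) := by
  refine cov_unique D.NA D.Mj (fun k hk => Mj_pos_ker hL hP k k.2 (fun h => hk (Subtype.ext h))) _ _
    (covOp_mem D.NA D.Mj) (fun J => ?_) (fun n J => B6SectCPositivity.Gt_sol hL hP n J) (fun n J => ?_)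
  · exact B6Eq2130.Q_tildeOp _ D.Qv (LinearMap.adjoint D.Qv) _ (QGaQ_comp_inverse a' hL hP hap) J
  · exact B6Eq2130.tildeOp_sol D.Mj _ D.Qv (LinearMap.adjoint D.Qv) a' _ Qvs_adj (MjQa_comp_inverse a' hL hP hap) n J n.2

/-- **THE WEIGHT IS FREE — `G̃_j = (I − H_jQ_j)G′`** for every positive-definite weight `a′`, `G′ = (Δ − ∂P_j∂* + Q_j*a′Q_j)⁻¹`.
[cite: Balaban1984PropagatorsII, (2.130)–(2.131) p.246] -/
theorem Gt_eq_comp_weight (hL : D.IsLattice) (hP : D.Positive) (hap : ∀ x : Bs, x ≠ 0 → 0 < ⟪x, a' x⟫_ℝ) :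
    D.Gt = (LinearMap.id - D.Hj ∘ₗ D.Qv) ∘ₗ Ring.inverse (D.Mj + LinearMap.adjoint D.Qv ∘ₗ a' ∘ₗ D.Qv) := by
  rw [Gt_eq_tildeOp_weight a' hL hP hap, Hj_eq_hOp_weight a' hL hP hap]
  refine LinearMap.ext fun J => ?_
  simp only [B6SectA.tildeOp, B6SectA.hOp, LinearMap.sub_apply, LinearMap.comp_apply, LinearMap.id_apply]

/-- pointwise: `G̃_jJ = G′J − H_j(Q_jG′J)`. [cite: Balaban1984PropagatorsII, (2.130)–(2.131) p.246] -/
theorem Gt_apply_weight (hL : D.IsLattice) (hP : D.Positive) (hap : ∀ x : Bs, x ≠ 0 → 0 < ⟪x, a' x⟫_ℝ) (J : A) :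
    D.Gt J = Ring.inverse (D.Mj + LinearMap.adjoint D.Qv ∘ₗ a' ∘ₗ D.Qv) J -
      D.Hj (D.Qv (Ring.inverse (D.Mj + LinearMap.adjoint D.Qv ∘ₗ a' ∘ₗ D.Qv) J)) := by
  conv_lhs => rw [Gt_eq_comp_weight a' hL hP hap]
  rfl

/-- pointwise: `H_jB = G′Q_j*E′B`, `E′ = (Q_jG′Q_j*)⁻¹`. [cite: Balaban1984PropagatorsII, (2.130) p.246] -/
theorem Hj_apply_weight (hL : D.IsLattice) (hP : D.Positive) (hap : ∀ x : Bs, x ≠ 0 → 0 < ⟪x, a' x⟫_ℝ) (b : Bs) :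
    D.Hj b = Ring.inverse (D.Mj + LinearMap.adjoint D.Qv ∘ₗ a' ∘ₗ D.Qv) (LinearMap.adjoint D.Qv
      (Ring.inverse (D.Qv ∘ₗ Ring.inverse (D.Mj + LinearMap.adjoint D.Qv ∘ₗ a' ∘ₗ D.Qv) ∘ₗ LinearMap.adjoint D.Qv) b)) := by
  conv_lhs => rw [Hj_eq_hOp_weight a' hL hP hap]
  rfl

end Weight

/-- **scalar weights**: for `w > 0`, `G̃_j = (I − H_jQ_j)(M_j + wQ_j*Q_j)⁻¹` — the form in which [4]'s propagator `Δ_a⁻¹` with `a = w`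
enters. [cite: Balaban1984PropagatorsII, (2.130)–(2.131) p.246] -/
theorem Gt_eq_comp_smul (hL : D.IsLattice) (hP : D.Positive) {w : ℝ} (hw : 0 < w) :
    D.Gt = (LinearMap.id - D.Hj ∘ₗ D.Qv) ∘ₗ Ring.inverse (D.Mj + LinearMap.adjoint D.Qv ∘ₗ (w • LinearMap.id) ∘ₗ D.Qv) :=
  Gt_eq_comp_weight (w • LinearMap.id) hL hP (fun x hx => by
    rw [LinearMap.smul_apply, LinearMap.id_apply, real_inner_smul_right, real_inner_self_eq_norm_sq]
    exact mul_pos hw (by positivity))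

/-- the scalar-weight operator is `M_j + w·Q_j*Q_j`. [cite: Balaban1984PropagatorsII, (2.19) p.226] -/
theorem MjQ_smul_eq (w : ℝ) :
    D.Mj + LinearMap.adjoint D.Qv ∘ₗ (w • LinearMap.id) ∘ₗ D.Qv = D.Mj + w • (LinearMap.adjoint D.Qv ∘ₗ D.Qv) := by
  congr 1
  refine LinearMap.ext fun v => ?_
  simp only [LinearMap.coe_comp, Function.comp_apply, LinearMap.smul_apply, LinearMap.id_apply, map_smul]

end Abstract

/-! ## §5  For the concrete two-scale data `tsV1` -/

section Concrete

variable {P : Params} {c : ℝ} (hc : c ≠ 0) {j : ℕ} (hj : j + 1 ≤ P.m + P.K) (Λ' : Finset (Site P (j + 1)))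
  {w : CIdx j Λ' → ℝ} (hw : ∀ i, 0 < w i)

include hj hw

/-- **(2.129) AS AN OPERATOR IDENTITY FOR THE CONCRETE TWO-SCALE OPERATORS** of `tsV1` (hypotheses: `c ≠ 0`, `j + 1 ≤ m + K`, `w > 0` only).
[cite: Balaban1984PropagatorsII, (2.129) p.246] -/
theorem G_eq_op_V1 :
    (tsV1 hc Λ' w).G = (tsV1 hc Λ' w).K1 + LinearMap.adjoint (LinearMap.id - (tsV1 hc Λ' w).K2) ∘ₗ
      ((tsV1 hc Λ' w).Gt + (tsV1 hc Λ' w).Hj ∘ₗ (tsV1 hc Λ' w).Ct ∘ₗ LinearMap.adjoint (tsV1 hc Λ' w).Hj) ∘ₗ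
        (LinearMap.id - (tsV1 hc Λ' w).K2) :=
  G_eq_op (isLattice Λ' hc hj hw) (positive Λ' hc hj w)

/-- pointwise. [cite: Balaban1984PropagatorsII, (2.129) p.246] -/
theorem G_apply_V1 (J : BondSpace P) :
    (tsV1 hc Λ' w).G J = (tsV1 hc Λ' w).K1 J + LinearMap.adjoint (LinearMap.id - (tsV1 hc Λ' w).K2)
      (((tsV1 hc Λ' w).Gt + (tsV1 hc Λ' w).Hj ∘ₗ (tsV1 hc Λ' w).Ct ∘ₗ LinearMap.adjoint (tsV1 hc Λ' w).Hj) (J - (tsV1 hc Λ' w).K2 J)) :=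
  G_apply (isLattice Λ' hc hj hw) (positive Λ' hc hj w) J

/-- **`G̃_j = (I − H_jQ_j)G_j`** for `tsV1`. [cite: Balaban1984PropagatorsII, (2.130)–(2.131) p.246] -/
theorem Gt_eq_comp_Gj_V1 :
    (tsV1 hc Λ' w).Gt = (LinearMap.id - (tsV1 hc Λ' w).Hj ∘ₗ (tsV1 hc Λ' w).Qv) ∘ₗ (tsV1 hc Λ' w).Gj :=
  Gt_eq_comp_Gj (isLattice Λ' hc hj hw) (positive Λ' hc hj w)

/-- **`G̃_j = (I − H_jQ_j)(M_j + w′Q_j*Q_j)⁻¹` for `tsV1` and EVERY `w′ > 0`** (the weight under which [4]'s Prop. 1.2 will be quoted is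
`w′ = a·(L^j)^d`, r03's dictionary). [cite: Balaban1984PropagatorsII, (2.130)–(2.131) p.246] -/
theorem Gt_eq_comp_smul_V1 {w' : ℝ} (hw' : 0 < w') :
    (tsV1 hc Λ' w).Gt = (LinearMap.id - (tsV1 hc Λ' w).Hj ∘ₗ (tsV1 hc Λ' w).Qv) ∘ₗ
      Ring.inverse ((tsV1 hc Λ' w).Mj + LinearMap.adjoint (tsV1 hc Λ' w).Qv ∘ₗ (w' • LinearMap.id) ∘ₗ (tsV1 hc Λ' w).Qv) :=
  Gt_eq_comp_smul (isLattice Λ' hc hj hw) (positive Λ' hc hj w) hw'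

/-- **`H_j = G′Q_j*(Q_jG′Q_j*)⁻¹` with `G′ = (M_j + w′Q_j*Q_j)⁻¹` for `tsV1` and every `w′ > 0`.** [cite: Balaban1984PropagatorsII, (2.130) p.246] -/
theorem Hj_eq_hOp_smul_V1 {w' : ℝ} (hw' : 0 < w') :
    (tsV1 hc Λ' w).Hj = B6SectA.hOp
      (Ring.inverse ((tsV1 hc Λ' w).Mj + LinearMap.adjoint (tsV1 hc Λ' w).Qv ∘ₗ (w' • LinearMap.id) ∘ₗ (tsV1 hc Λ' w).Qv))
      (LinearMap.adjoint (tsV1 hc Λ' w).Qv)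
      (Ring.inverse ((tsV1 hc Λ' w).Qv ∘ₗ
        Ring.inverse ((tsV1 hc Λ' w).Mj + LinearMap.adjoint (tsV1 hc Λ' w).Qv ∘ₗ (w' • LinearMap.id) ∘ₗ (tsV1 hc Λ' w).Qv) ∘ₗ
          LinearMap.adjoint (tsV1 hc Λ' w).Qv)) :=
  Hj_eq_hOp_weight (w' • LinearMap.id) (isLattice Λ' hc hj hw) (positive Λ' hc hj w) (fun x hx => by
    rw [LinearMap.smul_apply, LinearMap.id_apply, real_inner_smul_right, real_inner_self_eq_norm_sq]
    exact mul_pos hw' (by positivity))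

omit hj hw in
/-- `M_j`, `Q_j`, `H_j`, `G̃_j` of `tsV1` do not depend on `Λ′` nor on the weights (they are built from `Δ`, `∂`, `∂*`, `Q′_j`, `Q_j` only).
[cite: Balaban1984PropagatorsII, (2.130)–(2.131) p.246] -/
theorem Mj_Qv_Hj_Gt_indep (Λ'' : Finset (Site P (j + 1))) (w'' : CIdx j Λ'' → ℝ) :
    (tsV1 hc Λ' w).Mj = (tsV1 hc Λ'' w'').Mj ∧ (tsV1 hc Λ' w).Qv = (tsV1 hc Λ'' w'').Qv ∧
      (tsV1 hc Λ' w).Hj = (tsV1 hc Λ'' w'').Hj ∧ (tsV1 hc Λ' w).Gt = (tsV1 hc Λ'' w'').Gt :=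
  ⟨rfl, rfl, rfl, rfl⟩

end Concrete

end Literature.MathematicalPhysics.QuantumFieldTheory.Balaban1983to89.B6Repr2129Operator

end
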